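import Literature.Probability.Percolation.QuadCrossingNullFrontier
import Literature.Probability.Percolation.QuadCrossingReparam
import HarnessLib

/-!
# Null boundaries along any monotone strictly dominated family of quads

Topic `Literature/Probability/Percolation`; proofs only.  `QuadCrossingNullFrontier.lean` proves, for
the explicit perturbation family `Q_s = shrinkFamily H … s`, that `μ(∂⊞_{Q_s}) = 0` at every
continuity parameter of `s ↦ μ(⊞_{Q_s})` and hence for all but countably many `s`.  The argument
uses only two features of the family — the crossing events increase with `s`, and `Q_t < Q_s`
strictly for `s < t` inside the parameter interval — so it applies verbatim to ANY family with these
properties, e.g. to the reparametrised families `s ↦ (shrinkFamily H … s).reparam k`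
(`QuadCrossingReparam.lean`) used for general position in Theorem 1.7.  This file records that
abstraction:

* `measure_frontier_crossedEvent_eq_zero_of_continuousAt_of_family`,
* `countable_setOf_measure_frontier_crossedEvent_ne_zero_of_family`,
* `exists_mem_Ioo_notMem_measure_frontier_eq_zero_of_family`.

## References

* O. Schramm, S. Smirnov, Ann. Probab. 39 (2011), Lemma 5.1 (proof) and proof of Thm. 1.7.
  [SchrammSmirnov2011]
-/

noncomputable section

open Set Metric MeasureTheory Filter Topology
open scoped unitInterval ENNReal

namespace Literature.Probability.Percolation

namespace QuadCrossing

namespace Quad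

variable {D : Set ℂ}

section Family

variable {fam : ℝ → Quad D} {τ : ℝ}
  (hmono : ∀ s t, s ≤ t → QuadConfig.crossedEvent (fam s) ⊆ QuadConfig.crossedEvent (fam t))
  (hstrict : ∀ s t, 0 ≤ s → s < t → t ≤ τ → StrictlyDominated (fam t) (fam s))

include hmono hstrict

/-- **Null boundary at every continuity parameter** of `s ↦ μ(⊞_{Q_s})`, for a family whose
crossing events increase and whose members are strictly ordered on `[0, τ]`.
[cite: SchrammSmirnov2011, Lemma 5.1 (proof)] -/
theorem measure_frontier_crossedEvent_eq_zero_of_continuousAt_of_family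
    (μ : Measure (QuadConfig D)) [IsFiniteMeasure μ] {s₀ : ℝ} (hs₀ : s₀ ∈ Ioo 0 τ)
    (hcont : ContinuousAt (fun s => (μ (QuadConfig.crossedEvent (fam s))).toReal) s₀) :
    μ (frontier (QuadConfig.crossedEvent (fam s₀))) = 0 := by
  set g : ℝ → ℝ := fun s => (μ (QuadConfig.crossedEvent (fam s))).toReal with hg
  refine ((ENNReal.toReal_eq_zero_iff _).1
    (le_antisymm (le_of_forall_pos_le_add fun δ' hδ' => ?_) ENNReal.toReal_nonneg)).resolve_right
    (measure_ne_top _ _)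
  rw [zero_add]
  obtain ⟨ρ, hρ, hgρ⟩ := Metric.continuousAt_iff.1 hcont (δ' / 2) (half_pos hδ')
  set ρ' : ℝ := min ρ (min s₀ (τ - s₀)) / 2 with hρ'
  have hρ'₀ : 0 < ρ' := by
    have : 0 < min ρ (min s₀ (τ - s₀)) := lt_min hρ (lt_min hs₀.1 (by linarith [hs₀.2]))
    rw [hρ']; linarith
  have hρ'ρ : ρ' < ρ := by
    have := min_le_left ρ (min s₀ (τ - s₀)); rw [hρ']; linarith
  have hρ's : ρ' < s₀ := by
    have := (min_le_right ρ _).trans (min_le_left s₀ (τ - s₀)); rw [hρ']; linarith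
  have hρ'τ : ρ' < τ - s₀ := by
    have := (min_le_right ρ _).trans (min_le_right s₀ (τ - s₀)); rw [hρ']; linarith
  set s : ℝ := s₀ - ρ' with hs_def
  set t : ℝ := s₀ + ρ' with ht_def
  set m : ℝ := (s + s₀) / 2 with hm_def
  have h0s : 0 < s := by rw [hs_def]; linarith
  have hsm : s < m := by rw [hm_def]; linarith
  have hms₀ : m < s₀ := by rw [hm_def]; linarith
  have hs₀t : s₀ < t := by rw [ht_def]; linarith
  have htτ : t < τ := by rw [ht_def]; linarith
  have h1 : StrictlyDominated (fam t) (fam s₀) := hstrict s₀ t hs₀.1.le hs₀t htτ.le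
  have h2 : StrictlyDominated (fam s₀) (fam m) := hstrict m s₀ (by linarith) hms₀ hs₀.2.le
  have h3 : StrictlyDominated (fam m) (fam s) := hstrict s m h0s.le hsm (by linarith)
  have hle := QuadConfig.measure_frontier_crossedEvent_le μ h1 h2 h3
  have hst : μ (QuadConfig.crossedEvent (fam s)) ≤ μ (QuadConfig.crossedEvent (fam t)) :=
    measure_mono (hmono s t (by linarith))
  have hgs : dist (g s) (g s₀) < δ' / 2 :=
    hgρ (by rw [dist_eq_norm, hs_def]; simp [abs_of_pos hρ'₀, hρ'ρ])
  have hgt : dist (g t) (g s₀) < δ' / 2 :=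
    hgρ (by rw [dist_eq_norm, ht_def]; simp [abs_of_pos hρ'₀, hρ'ρ])
  rw [Real.dist_eq, abs_lt] at hgs hgt
  calc (μ (frontier (QuadConfig.crossedEvent (fam s₀)))).toReal
      ≤ (μ (QuadConfig.crossedEvent (fam t)) - μ (QuadConfig.crossedEvent (fam s))).toReal :=
        ENNReal.toReal_mono (ENNReal.sub_ne_top (measure_ne_top _ _)) hle
    _ = g t - g s := by rw [hg]; exact ENNReal.toReal_sub_of_le hst (measure_ne_top _ _)
    _ ≤ δ' := by linarith [hgs.1, hgt.2]

/-- **All but countably many members are `μ`-continuity quads.**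
[cite: SchrammSmirnov2011, Lemma 5.1 (proof) and proof of Thm. 1.7] -/
theorem countable_setOf_measure_frontier_crossedEvent_ne_zero_of_family
    (μ : Measure (QuadConfig D)) [IsFiniteMeasure μ] :
    {s : ℝ | s ∈ Ioo 0 τ ∧ μ (frontier (QuadConfig.crossedEvent (fam s))) ≠ 0}.Countable := by
  set g : ℝ → ℝ := fun s => (μ (QuadConfig.crossedEvent (fam s))).toReal with hg
  have hgmono : Monotone g := fun s t hst =>
    ENNReal.toReal_mono (measure_ne_top _ _) (measure_mono (hmono s t hst))
  refine hgmono.countable_not_continuousAt.mono ?_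
  rintro s ⟨hs, hne⟩ hcont
  exact hne (measure_frontier_crossedEvent_eq_zero_of_continuousAt_of_family hmono hstrict μ hs hcont)

/-- Hence a good parameter exists off any countable set, indeed off any Lebesgue-null set together
with any countable set: the bad parameters are Lebesgue-null. [cite: SchrammSmirnov2011, Lemma 5.1 (proof)] -/
theorem exists_mem_Ioo_notMem_measure_frontier_eq_zero_of_family (hτpos : 0 < τ)
    (μ : Measure (QuadConfig D)) [IsFiniteMeasure μ] {C : Set ℝ} (hC : C.Countable)
    {N : Set ℝ} (hN : (volume : Measure ℝ) N = 0) :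
    ∃ s ∈ Ioo 0 τ, s ∉ C ∧ s ∉ N ∧ μ (frontier (QuadConfig.crossedEvent (fam s))) = 0 := by
  have hbad : (volume : Measure ℝ) ({s : ℝ | s ∈ Ioo 0 τ ∧
      μ (frontier (QuadConfig.crossedEvent (fam s))) ≠ 0} ∪ C ∪ N) = 0 := by
    rw [measure_union_null_iff, measure_union_null_iff]
    exact ⟨⟨(countable_setOf_measure_frontier_crossedEvent_ne_zero_of_family hmono hstrict μ).measure_zero _,
      hC.measure_zero _⟩, hN⟩
  have hpos : 0 < (volume : Measure ℝ) (Ioo 0 τ) := by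
    rw [Real.volume_Ioo]; simpa using hτpos
  obtain ⟨s, hs, hsc⟩ : (Ioo 0 τ \ ({s : ℝ | s ∈ Ioo 0 τ ∧
      μ (frontier (QuadConfig.crossedEvent (fam s))) ≠ 0} ∪ C ∪ N)).Nonempty := by
    by_contra h
    rw [not_nonempty_iff_eq_empty, sdiff_eq_empty] at h
    exact absurd (measure_mono_null h hbad) hpos.ne'
  simp only [mem_union, mem_setOf_eq, not_or, not_and, not_not] at hsc
  exact ⟨s, hs, hsc.1.2, hsc.2, hsc.1.1 hs⟩

end Family

/-- The reparametrised perturbation family satisfies the two hypotheses: events increase, members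
strictly ordered on `[0, τ]`. [folklore] -/
theorem shrinkFamily_reparam_hypotheses (H : ℂ ≃ₜ ℂ) {τ : ℝ} (hτ₀ : 0 ≤ τ) (hτ : τ ≤ 1 / 2)
    (hmem : ∀ a b : ℝ, |a - 1| ≤ τ → |b - 1| ≤ τ → ∀ p : I × I, H (rectMap a b p) ∈ D)
    {k : I × I ≃ₜ I × I} (hk : SidePreserving k) :
    (∀ s t, s ≤ t → QuadConfig.crossedEvent ((shrinkFamily H hτ₀ hτ hmem s).reparam k) ⊆
        QuadConfig.crossedEvent ((shrinkFamily H hτ₀ hτ hmem t).reparam k)) ∧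
      (∀ s t, 0 ≤ s → s < t → t ≤ τ →
        StrictlyDominated ((shrinkFamily H hτ₀ hτ hmem t).reparam k)
          ((shrinkFamily H hτ₀ hτ hmem s).reparam k)) := by
  have hstrict' : ∀ s t, clampTo τ s < clampTo τ t →
      StrictlyDominated ((shrinkFamily H hτ₀ hτ hmem t).reparam k)
        ((shrinkFamily H hτ₀ hτ hmem s).reparam k) := fun s t hst =>
    (strictlyDominated_reparam_iff hk).2 (strictlyDominated_shrinkFamily H hτ₀ hτ hmem hst)
  refine ⟨fun s t hst S hS => ?_, fun s t h0 hst htτ => hstrict' s t ?_⟩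
  · rcases (clampTo_mono τ hst).eq_or_lt with heq | hlt
    · have : shrinkFamily H hτ₀ hτ hmem s = shrinkFamily H hτ₀ hτ hmem t := shrinkFamily_congr H hτ₀ hτ hmem heq
      rw [← this]; exact hS
    · exact S.isLowerQuadSet hS (hstrict' s t hlt)
  · rw [clampTo_of_mem h0 (hst.le.trans htτ), clampTo_of_mem (h0.trans hst.le) htτ]; exact hst

end Quad

end QuadCrossing

end Literature.Probability.Percolation

end
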